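import Mathlib
import Literature.Computability.AlgebraicComplexity.LocalStrongUSP
import Summits.MatrixMultiplication.MatrixMultiplication.Theses.ThinBlockAlpha
-- (the two LANDED stub modules are not imported while the farm snapshot lags; their `sorry`s below are
--  placeholders for `…Theorems.SkewLocalStrongUSP.stub_concatWitness` (p86070) / `.stub_transport` (p86159))

/-!
# Line `Concat` (graded tilted alphabets) — lead's skeleton for crux `SkewLocalStrongUSP`
(stmt-MatrixMultiplication-10598, route `ThinBlockAlpha`)

Lead `prover-line-stmt-MatrixMultiplication-10598-0`, 2026-08-16.  Idea card
`Cruxes/SkewLocalStrongUSP/Ideas/graded-tilted-alphabets.md` (ideator 2, gen 2), which extends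
`tilted-alphabet-lp-duality` / `tilted-sunflowers` (same LP-tilt lever; merged here as the
composition-`(1,…,1)` special case), sharpened by TRIAGE-r1-1 / TRIAGE-r1-2.

THE LINE.  A *tilted alphabet* is a family of letters `e : Fin N → Fin b → Fin 3` with rational
potentials `f g h : Fin N → ℚ`, `f x + g x + h x = 0`, such that every ordered triple of letters
`(x, y, z)` not all equal that FAILS (no column carries one of CKSU's six local-strong-USP patterns)
has `0 < f x + g y + h z`.  Over a tilted alphabet EVERY constant-composition code is a local strong USP
after concatenation (`stub_concatWitness`: sum the potential over the blocks — it vanishes by constant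
composition, yet every block of a failing word-triple contributes `≥ 0` and a block with letters not all
equal contributes `> 0`).  Two LINEAR laws on the composition put every codeword in the exact class
`(3k, k, 3k)` at width `m·b = 7k`, and `stub_transport` re-indexes `Fin m × Fin b ≃ Fin (7k)`.  Hence the
crux follows from `GradedTiltedCodes` (`C⁺`, `stub_codes`): tilted alphabets whose constant-composition
codes in the class have size `≥ C(7k,k)·2^{-δk}` for every `δ > 0` and infinitely many `k`.

STATUS OF THE STUBS (v2).  `stub_concatWitness` [LANDED p86070], `stub_transport` [LANDED p86159], `stub_codes` [XL — OPEN; capacity-equivalent to the crux by CKSU Lemma 32 / Prop. 34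
(triage r1-1, r1-2): a local strong USP in the class is a tilted alphabet with no failing triples, `b = 7k`,
`m = 1`; held by the lead].  Kernel-checked finite rungs of `C⁺` at width `b = 7` (tilt certificates by
`decide`): 10/11/15/14-letter graded alphabets, rates `1.3687 / 1.3985 / 1.4195 / 1.4244` per column
against the cap `2^{h(1/7)} = 1.50699`; width-7 graded ceiling `≤ 1.5010` (triage r1-1), so `δ → 0` needs
`b → ∞`.

DISPROOF USED (`Cruxes/SkewLocalStrongUSP/Disproof.lean`, cdisprove cycle 1, read in full): no
`_false_without_` theorem, §5 Targets empty.  Honoured: §1 `oneSet_injOn` / `card_le_choose` (tilted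
alphabets have injective letters — `tilted_injective` below — and word-level one-set injectivity is
automatic, so every rung sits strictly below the cap, consistent with §3 `card_lt_choose_of_furedi`);
§2(a) (degenerate triples are the content: the tilt pays for them with the potential); §4 (slice rank /
support functionals silent at `a = 1/3`): irrelevant to a construction line.
-/

set_option linter.dupNamespace false

namespace Summit.MatrixMultiplication.MatrixMultiplication.Cruxes.SkewLocalStrongUSP.Concat

open Finset
open Literature.Computability.AlgebraicComplexity (localStrongUSPPatterns)
open Summit.MatrixMultiplication.MatrixMultiplication.Theses.ThinBlockAlpha (SkewLocalStrongUSP)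

/-! ## Objects (documentation names; the registered stubs below are stated in explicit tree vocabulary) -/

/-- A triple of width-`b` rows FAILS if no column carries an admissible local-strong-USP pattern. -/
def Fails {b : ℕ} (u v w : Fin b → Fin 3) : Prop :=
  ∀ i, (u i, v i, w i) ∉ localStrongUSPPatterns

/-- A **tilted alphabet**: letters `e x` with potentials `f + g + h = 0` letterwise and
`f x + g y + h z > 0` on every failing triple of letters not all equal (LP-dual certificate). -/
def IsTilted {N b : ℕ} (e : Fin N → Fin b → Fin 3) : Prop :=
  ∃ f g h : Fin N → ℚ, (∀ x, f x + g x + h x = 0) ∧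
    ∀ x y z, (x ≠ y ∨ y ≠ z) → Fails (e x) (e y) (e z) → 0 < f x + g y + h z

/-- **`C⁺` = graded tilted codes**: for every `δ > 0` and infinitely many `k`, a tilted alphabet of some
width `b` and a constant-composition code `W` of length `m`, `m·b = 7k`, all of whose concatenated words lie
in the class `(3k, k, 3k)`, with `C(7k,k) ≤ 2^{δk}·|W|`. -/
def GradedTiltedCodes : Prop :=
  ∀ δ : ℝ, 0 < δ → ∀ k₀ : ℕ, ∃ k : ℕ, k₀ ≤ k ∧
    ∃ (N b m : ℕ) (e : Fin N → Fin b → Fin 3) (f g h : Fin N → ℚ) (W : Finset (Fin m → Fin N)),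
      m * b = 7 * k ∧
      (∀ x, f x + g x + h x = 0) ∧
      (∀ x y z, (x ≠ y ∨ y ≠ z) → (∀ i, (e x i, e y i, e z i) ∉ localStrongUSPPatterns) →
        0 < f x + g y + h z) ∧
      (∀ ω₁ ∈ W, ∀ ω₂ ∈ W, ∀ x,
        (univ.filter fun j => ω₁ j = x).card = (univ.filter fun j => ω₂ j = x).card) ∧
      (∀ ω ∈ W, (univ.filter fun p : Fin m × Fin b => e (ω p.1) p.2 = 0).card = 3 * k ∧
        (univ.filter fun p : Fin m × Fin b => e (ω p.1) p.2 = 1).card = k) ∧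
      ((7 * k).choose k : ℝ) ≤ (2 : ℝ) ^ (δ * k) * W.card


/-- Statement of `stub_concatWitness` (named form): a constant-composition word-triple over a tilted alphabet,
not all equal, has an admissible column. -/
def ConcatWitness : Prop :=
  ∀ (N b m : ℕ) (e : Fin N → Fin b → Fin 3) (f g h : Fin N → ℚ),
    (∀ x, f x + g x + h x = 0) →
    (∀ x y z, (x ≠ y ∨ y ≠ z) → (∀ i, (e x i, e y i, e z i) ∉ localStrongUSPPatterns) →
      0 < f x + g y + h z) →
    ∀ (ω₁ ω₂ ω₃ : Fin m → Fin N),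
      (∀ x, (univ.filter fun j => ω₁ j = x).card = (univ.filter fun j => ω₂ j = x).card) →
      (∀ x, (univ.filter fun j => ω₂ j = x).card = (univ.filter fun j => ω₃ j = x).card) →
      (ω₁ ≠ ω₂ ∨ ω₂ ≠ ω₃) →
      ∃ p : Fin m × Fin b, (e (ω₁ p.1) p.2, e (ω₂ p.1) p.2, e (ω₃ p.1) p.2) ∈ localStrongUSPPatterns

/-- Statement of `stub_transport` (named form): re-indexing bookkeeping `Fin m × Fin b ≃ Fin (7k)`. -/
def Transport : Prop :=
  ∀ (k m b N : ℕ), m * b = 7 * k → ∀ (e : Fin N → Fin b → Fin 3) (W : Finset (Fin m → Fin N)),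
    Function.Injective e →
    (∀ ω₁ ∈ W, ∀ ω₂ ∈ W, ∀ ω₃ ∈ W, (ω₁ ≠ ω₂ ∨ ω₂ ≠ ω₃) →
      ∃ p : Fin m × Fin b, (e (ω₁ p.1) p.2, e (ω₂ p.1) p.2, e (ω₃ p.1) p.2) ∈ localStrongUSPPatterns) →
    (∀ ω ∈ W, (univ.filter fun p : Fin m × Fin b => e (ω p.1) p.2 = 0).card = 3 * k ∧
      (univ.filter fun p : Fin m × Fin b => e (ω p.1) p.2 = 1).card = k) →
    ∃ U : Finset (Fin (7 * k) → Fin 3),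
      (∀ u ∈ U, ∀ v ∈ U, ∀ w ∈ U, (u ≠ v ∨ v ≠ w) → ∃ i, (u i, v i, w i) ∈
        ({((0 : Fin 3), (1 : Fin 3), (0 : Fin 3)), (0, 1, 1), (0, 0, 2), (0, 2, 2), (1, 1, 2), (2, 1, 2)} :
          Finset (Fin 3 × Fin 3 × Fin 3))) ∧
      (∀ u ∈ U, (univ.filter fun i => u i = 0).card = 3 * k ∧
        (univ.filter fun i => u i = 1).card = k) ∧
      U.card = W.card

/-- **The transfer** `C⁺ → crux` as a named statement (the card's first lemma
`skewLocalStrongUSP_of_gradedTilted`). -/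
def CodesTransfer : Prop := GradedTiltedCodes → SkewLocalStrongUSP

/-! ## Registered stubs (the only `sorry`s of the line) -/

/-- **stub_concatWitness** — a constant-composition word-triple over a tilted alphabet, not all equal, has an
admissible column. [LANDED p86070 — `Theorems/ThinBlockAlphaSkewLocalStrongUSPStubConcatWitness.lean`] -/
theorem stub_concatWitness :
    ∀ (N b m : ℕ) (e : Fin N → Fin b → Fin 3) (f g h : Fin N → ℚ),
      (∀ x, f x + g x + h x = 0) →
      (∀ x y z, (x ≠ y ∨ y ≠ z) → (∀ i, (e x i, e y i, e z i) ∉ localStrongUSPPatterns) →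
        0 < f x + g y + h z) →
      ∀ (ω₁ ω₂ ω₃ : Fin m → Fin N),
        (∀ x, (univ.filter fun j => ω₁ j = x).card = (univ.filter fun j => ω₂ j = x).card) →
        (∀ x, (univ.filter fun j => ω₂ j = x).card = (univ.filter fun j => ω₃ j = x).card) →
        (ω₁ ≠ ω₂ ∨ ω₂ ≠ ω₃) →
        ∃ p : Fin m × Fin b, (e (ω₁ p.1) p.2, e (ω₂ p.1) p.2, e (ω₃ p.1) p.2) ∈ localStrongUSPPatterns := by
  sorry -- LANDED p86070: exact Summit.MatrixMultiplication.MatrixMultiplication.Theorems.SkewLocalStrongUSP.stub_concatWitness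

/-- **stub_transport** — re-indexing bookkeeping: an injectively-lettered code with the witness property and
the class laws, read through `Fin m × Fin b ≃ Fin (7k)`, is a family `U` of the crux's shape with `|U| = |W|`.
[LANDED p86159 — `Theorems/ThinBlockAlphaSkewLocalStrongUSPStubTransport.lean`] -/
theorem stub_transport :
    ∀ (k m b N : ℕ), m * b = 7 * k → ∀ (e : Fin N → Fin b → Fin 3) (W : Finset (Fin m → Fin N)),
      Function.Injective e →
      (∀ ω₁ ∈ W, ∀ ω₂ ∈ W, ∀ ω₃ ∈ W, (ω₁ ≠ ω₂ ∨ ω₂ ≠ ω₃) →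
        ∃ p : Fin m × Fin b, (e (ω₁ p.1) p.2, e (ω₂ p.1) p.2, e (ω₃ p.1) p.2) ∈ localStrongUSPPatterns) →
      (∀ ω ∈ W, (univ.filter fun p : Fin m × Fin b => e (ω p.1) p.2 = 0).card = 3 * k ∧
        (univ.filter fun p : Fin m × Fin b => e (ω p.1) p.2 = 1).card = k) →
      ∃ U : Finset (Fin (7 * k) → Fin 3),
        (∀ u ∈ U, ∀ v ∈ U, ∀ w ∈ U, (u ≠ v ∨ v ≠ w) → ∃ i, (u i, v i, w i) ∈
          ({((0 : Fin 3), (1 : Fin 3), (0 : Fin 3)), (0, 1, 1), (0, 0, 2), (0, 2, 2), (1, 1, 2), (2, 1, 2)} :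
            Finset (Fin 3 × Fin 3 × Fin 3))) ∧
        (∀ u ∈ U, (univ.filter fun i => u i = 0).card = 3 * k ∧
          (univ.filter fun i => u i = 1).card = k) ∧
        U.card = W.card := by
  sorry -- LANDED p86159: exact Summit.MatrixMultiplication.MatrixMultiplication.Theorems.SkewLocalStrongUSP.stub_transport

/-- **stub_codes** — `C⁺ = GradedTiltedCodes` (verbatim). [XL, OPEN — capacity-equivalent to the crux; held
by the lead] -/
theorem stub_codes :
    ∀ δ : ℝ, 0 < δ → ∀ k₀ : ℕ, ∃ k : ℕ, k₀ ≤ k ∧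
      ∃ (N b m : ℕ) (e : Fin N → Fin b → Fin 3) (f g h : Fin N → ℚ) (W : Finset (Fin m → Fin N)),
        m * b = 7 * k ∧
        (∀ x, f x + g x + h x = 0) ∧
        (∀ x y z, (x ≠ y ∨ y ≠ z) → (∀ i, (e x i, e y i, e z i) ∉ localStrongUSPPatterns) →
          0 < f x + g y + h z) ∧
        (∀ ω₁ ∈ W, ∀ ω₂ ∈ W, ∀ x,
          (univ.filter fun j => ω₁ j = x).card = (univ.filter fun j => ω₂ j = x).card) ∧
        (∀ ω ∈ W, (univ.filter fun p : Fin m × Fin b => e (ω p.1) p.2 = 0).card = 3 * k ∧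
          (univ.filter fun p : Fin m × Fin b => e (ω p.1) p.2 = 1).card = k) ∧
        ((7 * k).choose k : ℝ) ≤ (2 : ℝ) ^ (δ * k) * W.card := by
  sorry


/-! ### Side rung (unconditional partial result; not used by `SkewLocalStrongUSP_of`)

The crux's matrix at the FIXED slack `δ = 3/5`, for infinitely many `k`, from the kernel-checked
14-letter alphabet `A14` (rate `1.42411`/column with the integer composition `q14` per 60 blocks):
`stub_rungCount` is the method-of-types inequality, `stub_rungThreeFifths` the assembled statement. -/

/-- **stub_rungCount** — counting for the `A14` code at `k = 60M` blocks:
`C(420M, 60M) ≤ 2^{(3/5)·60M} · multinomial(60M; M·q14)` once `(60M+1)^14 ≤ 3^M`. [M, provable now] -/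
theorem stub_rungCount :
    ∀ M : ℕ, 1 ≤ M → (60 * M + 1) ^ 14 ≤ 3 ^ M →
      ((7 * (60 * M)).choose (60 * M) : ℝ) ≤
        (2 : ℝ) ^ ((3 / 5 : ℝ) * ((60 * M : ℕ) : ℝ)) *
          (Nat.multinomial univ (fun x : Fin 14 =>
            M * (![12, 5, 5, 5, 6, 5, 5, 5, 2, 2, 2, 2, 2, 2] : Fin 14 → ℕ) x) : ℝ) := by
  sorry

/-- **stub_rungThreeFifths** — the `δ₀ = 3/5` rung: the crux's matrix at slack `3/5` for infinitely
many `k` (skew local strong USPs of rate `1.42411` per column, from `A14`). [M, provable now from the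
landed stubs + the `A14` certificate] -/
theorem stub_rungThreeFifths : ∀ k₀ : ℕ, ∃ k : ℕ, k₀ ≤ k ∧ ∃ U : Finset (Fin (7 * k) → Fin 3),
    (∀ u ∈ U, ∀ v ∈ U, ∀ w ∈ U, (u ≠ v ∨ v ≠ w) → ∃ i, (u i, v i, w i) ∈
      ({((0 : Fin 3), (1 : Fin 3), (0 : Fin 3)), (0, 1, 1), (0, 0, 2), (0, 2, 2), (1, 1, 2), (2, 1, 2)} :
        Finset (Fin 3 × Fin 3 × Fin 3))) ∧
    (∀ u ∈ U, (univ.filter fun i => u i = 0).card = 3 * k ∧ (univ.filter fun i => u i = 1).card = k) ∧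
    ((7 * k).choose k : ℝ) ≤ (2 : ℝ) ^ ((3 / 5 : ℝ) * k) * U.card := by
  sorry

/-! The registered signatures ARE the named statements (definitional unfolding only). -/

example : ConcatWitness := stub_concatWitness
example : Transport := stub_transport
example : GradedTiltedCodes := stub_codes

/-! ## Composition (real proofs, no `sorry` below this line) -/

/-- A tilted alphabet has pairwise distinct letters: if `e x = e y` with `x ≠ y`, the triples `(x,y,y)` and
`(y,x,x)` are diagonal as rows, hence failing, so both potentials are positive — but they sum to
`(f+g+h)(x) + (f+g+h)(y) = 0`. -/
theorem tilted_injective {N b : ℕ} (e : Fin N → Fin b → Fin 3) (f g h : Fin N → ℚ)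
    (hsum : ∀ x, f x + g x + h x = 0)
    (htilt : ∀ x y z, (x ≠ y ∨ y ≠ z) → (∀ i, (e x i, e y i, e z i) ∉ localStrongUSPPatterns) →
      0 < f x + g y + h z) :
    Function.Injective e := by
  intro x y hxy
  by_contra hne
  have hdiag : ∀ i, (e y i, e y i, e y i) ∉ localStrongUSPPatterns := by
    intro i
    rw [Literature.Computability.AlgebraicComplexity.mem_localStrongUSPPatterns_iff]
    rcases (show e y i = 0 ∨ e y i = 1 ∨ e y i = 2 by
        have : ∀ a : Fin 3, a = 0 ∨ a = 1 ∨ a = 2 := by decide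
        exact this _) with h0 | h1 | h2
    · simp [h0]
    · simp [h1]
    · simp [h2]
  have h1 : 0 < f x + g y + h y := by
    refine htilt x y y (Or.inl hne) ?_
    intro i
    rw [hxy]
    exact hdiag i
  have h2 : 0 < f y + g x + h x := by
    refine htilt y x x (Or.inl (Ne.symm hne)) ?_
    intro i
    rw [← hxy]
    have hdiag' : ∀ i, (e x i, e x i, e x i) ∉ localStrongUSPPatterns := by
      intro i; rw [hxy]; exact hdiag i
    exact hdiag' i
  have := hsum x
  have := hsum y
  linarith

/-- **`C⁺ → crux`** (`CodesTransfer`, from the two tool stubs): graded tilted codes give skew local strong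
USPs. -/
theorem codesTransfer (hW : ConcatWitness) (hT : Transport) : CodesTransfer := by
  intro hC
  intro δ hδ k₀
  obtain ⟨k, hk, N, b, m, e, f, g, h, W, hbm, hsum, htilt, hcomp, hclass, hcount⟩ := hC δ hδ k₀
  have hinj : Function.Injective e := tilted_injective e f g h hsum htilt
  have hwit : ∀ ω₁ ∈ W, ∀ ω₂ ∈ W, ∀ ω₃ ∈ W, (ω₁ ≠ ω₂ ∨ ω₂ ≠ ω₃) →
      ∃ p : Fin m × Fin b, (e (ω₁ p.1) p.2, e (ω₂ p.1) p.2, e (ω₃ p.1) p.2) ∈ localStrongUSPPatterns := by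
    intro ω₁ h₁ ω₂ h₂ ω₃ h₃ hne
    exact hW N b m e f g h hsum htilt ω₁ ω₂ ω₃ (hcomp ω₁ h₁ ω₂ h₂) (hcomp ω₂ h₂ ω₃ h₃) hne
  obtain ⟨U, hU, hUclass, hUcard⟩ := hT k m b N hbm e W hinj hwit hclass
  refine ⟨k, hk, U, hU, hUclass, ?_⟩
  rw [hUcard]
  exact hcount

/-- **Composition (the skeleton theorem).** The crux `SkewLocalStrongUSP`, concluded BY NAME, as a closed
term over the three registered stubs. -/
theorem SkewLocalStrongUSP_of : SkewLocalStrongUSP :=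
  codesTransfer stub_concatWitness stub_transport stub_codes

end Summit.MatrixMultiplication.MatrixMultiplication.Cruxes.SkewLocalStrongUSP.Concat
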